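import Mathlib
import Summits.Schanuel.Schanuel.Theorems.SoloInformedDenisTransfer
import Summits.Schanuel.Schanuel.Theorems.SoloInformedRealGraphSector
import Summits.Schanuel.Schanuel.Theorems.RigidCoreSchanuelOnLogFreeCoreCalibrationR
import Literature.NumberTheory.Transcendental.GelfondExpLogConjectureProofs

/-!
# The logarithmic floor F2: "two algebraically independent logarithms of algebraic numbers"

Soloist seat `solo-Schanuel-informed`, session 14 (atlas §1 F2, typed).

The weakest open statement in the logarithmic sector of Schanuel's conjecture is
`TwoIndependentLogs`: there exist two logarithms of algebraic numbers that are algebraically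
independent over `ℚ` — "it is not yet even known that there exist at least two algebraically
independent logarithms of algebraic numbers" [Waldschmidt 2000, §1.4, p. 16]. Since `πi = log(−1)`
is itself such a logarithm and is transcendental, matroid exchange
(`algebraicIndependent_pair_exchange`, session 6) puts the statement in ONE-QUANTIFIER normal form
about `π` alone:

  `TwoIndependentLogs ↔ ∃ l, e^l ∈ ℚ̄ ∧ AI(π, l)`      (`twoIndependentLogs_iff_pi`),

i.e. its negation is the world in which EVERY logarithm of EVERY algebraic number is algebraic over
`ℚ(π)` (`not_twoIndependentLogs_iff`). Rank two of Schanuel's conjecture refutes that world through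
`log 2 ⟂ π` (`twoIndependentLogs_of_schanuelRank_two`, via the session-10 sector theorem
`logTwoPi_of_schanuelRank_two`).

No new transcendence input; statements over Mathlib's `AlgebraicIndependent`, the tree's
`SchanuelRank`, `RigidCore.CalibrationR.transcendental_pi_complex`, `transcendental_pi_mul_I` and the landed soloist lemmas
named above.

References: M. Waldschmidt, *Diophantine approximation on linear algebraic groups*, Springer 2000,
§1.4 (printed p. 16); J. Pila, *Point-counting and the Zilber–Pink conjecture*, CUP 2022, §13.5.
-/

noncomputable section

open Complex
open Literature.NumberTheory.Transcendental (SchanuelRank transcendental_pi_mul_I)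

namespace Summit.Schanuel.Schanuel.Theorems

/-- **F2, the logarithmic floor** (OPEN): two logarithms of algebraic numbers are algebraically
independent over `ℚ`. [cite: Waldschmidt2000, §1.4 p. 16 ("it is not yet even known that there
exist at least two algebraically independent logarithms of algebraic numbers")] -/
@[conjecture] def TwoIndependentLogs : Prop :=
  ∃ l₁ l₂ : ℂ, IsAlgebraic ℚ (cexp l₁) ∧ IsAlgebraic ℚ (cexp l₂) ∧ AlgebraicIndependent ℚ ![l₁, l₂]

/-! ### `π` versus `πi` -/

/-- `πi` and `π` are algebraically dependent (`(πi)² + π² = 0`). [folklore] -/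
theorem soloNot_algebraicIndependent_piI_pi :
    ¬ AlgebraicIndependent ℚ ![(Real.pi : ℂ) * I, (Real.pi : ℂ)] := by
  intro h
  have hp : (MvPolynomial.X 0 ^ 2 + MvPolynomial.X 1 ^ 2 : MvPolynomial (Fin 2) ℚ) ≠ 0 := by
    intro h0
    have := congr_arg (MvPolynomial.eval ![(1 : ℚ), 0]) h0
    simp at this
  refine hp (h.eq_zero_of_aeval_eq_zero _ ?_)
  simp only [map_add, map_pow, MvPolynomial.aeval_X, Matrix.cons_val_zero, Matrix.cons_val_one]
  ring_nf
  simp [Complex.I_sq]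

/-- `π` and `πi` are algebraically dependent (the swapped form). [folklore] -/
theorem soloNot_algebraicIndependent_pi_piI :
    ¬ AlgebraicIndependent ℚ ![(Real.pi : ℂ), (Real.pi : ℂ) * I] := by
  intro h
  have hp : (MvPolynomial.X 0 ^ 2 + MvPolynomial.X 1 ^ 2 : MvPolynomial (Fin 2) ℚ) ≠ 0 := by
    intro h0
    have := congr_arg (MvPolynomial.eval ![(1 : ℚ), 0]) h0
    simp at this
  refine hp (h.eq_zero_of_aeval_eq_zero _ ?_)
  simp only [map_add, map_pow, MvPolynomial.aeval_X, Matrix.cons_val_zero, Matrix.cons_val_one]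
  ring_nf
  simp [Complex.I_sq]

/-- `AI(π, l) → AI(πi, l)`: exchange against the transcendental `πi`, the alternative `AI(πi, π)`
being impossible. [folklore] -/
theorem algebraicIndependent_piI_of_pi {l : ℂ} (h : AlgebraicIndependent ℚ ![(Real.pi : ℂ), l]) :
    AlgebraicIndependent ℚ ![(Real.pi : ℂ) * I, l] := by
  rcases algebraicIndependent_pair_exchange transcendental_pi_mul_I h with h1 | h1
  · exact absurd h1 soloNot_algebraicIndependent_piI_pi
  · exact h1

/-- `AI(πi, l) → AI(π, l)`. [folklore] -/
theorem algebraicIndependent_pi_of_piI {l : ℂ} (h : AlgebraicIndependent ℚ ![(Real.pi : ℂ) * I, l]) :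
    AlgebraicIndependent ℚ ![(Real.pi : ℂ), l] := by
  rcases algebraicIndependent_pair_exchange RigidCore.CalibrationR.transcendental_pi_complex h
    with h1 | h1
  · exact absurd h1 soloNot_algebraicIndependent_pi_piI
  · exact h1

/-! ### The one-quantifier normal form -/

/-- **F2 in normal form**: two algebraically independent logarithms of algebraic numbers exist iff
SOME logarithm of SOME algebraic number is algebraically independent of `π`. (`→`: exchange against
the transcendental `π`; `←`: the pair `(πi, l)`, `e^{πi} = −1`.) [folklore] -/
theorem twoIndependentLogs_iff_pi :
    TwoIndependentLogs ↔ ∃ l : ℂ, IsAlgebraic ℚ (cexp l) ∧ AlgebraicIndependent ℚ ![(Real.pi : ℂ), l] := by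
  constructor
  · rintro ⟨l₁, l₂, h₁, h₂, h⟩
    rcases algebraicIndependent_pair_exchange RigidCore.CalibrationR.transcendental_pi_complex h
      with h' | h'
    · exact ⟨l₁, h₁, h'⟩
    · exact ⟨l₂, h₂, h'⟩
  · rintro ⟨l, hl, h⟩
    refine ⟨(Real.pi : ℂ) * I, l, ?_, hl, algebraicIndependent_piI_of_pi h⟩
    rw [Complex.exp_pi_mul_I]
    exact isAlgebraic_one.neg

/-- **The world `¬F2`**: every logarithm of every algebraic number is algebraically dependent on `π`
(i.e. algebraic over `ℚ(π)`). This is the hypothetical world no theorem in print refutes.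
[cite: Waldschmidt2000, §1.4 p. 16] -/
theorem not_twoIndependentLogs_iff :
    ¬ TwoIndependentLogs ↔
      ∀ l : ℂ, IsAlgebraic ℚ (cexp l) → ¬ AlgebraicIndependent ℚ ![(Real.pi : ℂ), l] := by
  rw [twoIndependentLogs_iff_pi]
  push Not
  rfl

/-! ### What rank two of Schanuel's conjecture gives -/

/-- Transfer of algebraic independence from `ℝ` to `ℂ` along the inclusion. [folklore] -/
theorem soloAlgebraicIndependent_complex_of_real {n : ℕ} (x : Fin n → ℝ)
    (h : AlgebraicIndependent ℚ x) : AlgebraicIndependent ℚ (fun i => (x i : ℂ)) := by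
  have h' := h.map' (f := (algebraMap ℝ ℂ).toRatAlgHom) (by
    intro a b hab
    simpa [RingHom.toRatAlgHom_apply] using hab)
  have : ((algebraMap ℝ ℂ).toRatAlgHom : ℝ → ℂ) ∘ x = fun i => (x i : ℂ) := by
    funext i
    simp [RingHom.toRatAlgHom_apply]
  rw [this] at h'
  exact h'

/-- `log 2 ⟂ π` (over `ℝ`) gives F2, with the witnesses `πi = log(−1)` and `log 2`. [folklore] -/
theorem twoIndependentLogs_of_logTwoPi (h : AlgebraicIndependent ℚ ![Real.log 2, Real.pi]) :
    TwoIndependentLogs := by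
  rw [twoIndependentLogs_iff_pi]
  have hc : AlgebraicIndependent ℚ ![((Real.log 2 : ℝ) : ℂ), (Real.pi : ℂ)] := by
    have := soloAlgebraicIndependent_complex_of_real ![Real.log 2, Real.pi] h
    convert this using 1
    funext i
    fin_cases i <;> simp
  refine ⟨((Real.log 2 : ℝ) : ℂ), ?_, ?_⟩
  · have hexp : cexp ((Real.log 2 : ℝ) : ℂ) = (2 : ℂ) := by
      rw [← Complex.ofReal_exp, Real.exp_log (by norm_num)]
      norm_num
    rw [hexp]
    simpa using isAlgebraic_algebraMap (R := ℚ) (A := ℂ) (2 : ℚ)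
  · rcases algebraicIndependent_pair_exchange RigidCore.CalibrationR.transcendental_pi_complex hc
      with h1 | h1
    · exact h1
    · -- `AI(π, π)` is impossible
      exfalso
      have h01 : (0 : Fin 2) = 1 := h1.injective (by simp)
      exact absurd h01 (by decide)

/-- **Rank two of Schanuel's conjecture ⟹ F2** (through `log 2 ⟂ π`, session 10's
`logTwoPi_of_schanuelRank_two`). -/
theorem twoIndependentLogs_of_schanuelRank_two (h : SchanuelRank 2) : TwoIndependentLogs :=
  twoIndependentLogs_of_logTwoPi (logTwoPi_of_schanuelRank_two h)

/-- The summit ⟹ F2. -/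
theorem twoIndependentLogs_of_schanuel (h : _root_.Schanuel) : TwoIndependentLogs :=
  twoIndependentLogs_of_schanuelRank_two (h 2)

end Summit.Schanuel.Schanuel.Theorems
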